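import Mathlib
import HarnessLib

/-!
# Martingale increments of a bounded adapted sequence: orthogonality and Chebyshev

Topic `Literature/Probability/Process` (generic discrete-time martingale tools; theorems only, no definition, no
named fact).  Standard facts around the Doob decomposition of a bounded adapted real sequence `Y n` along a
monotone family of sub-σ-algebras `G n` (textbook material, e.g. D. Williams, *Probability with Martingales*
(1991), §12.1–12.2 "Doob decomposition", §12.4 "angle-brackets process": martingale increments are orthogonal in
`L²`; R. Durrett, *Probability: Theory and Examples*, 4th ed., Thm. 5.4.7 ff.), in Mathlib's vocabulary
(`MeasureTheory.condExp`, notation `P[f | m]`, `Measure.trim`):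

* `condExp_ae_le_of_setIntegral_le` — `P[f | m] ≤ g` a.e. for an `m`-measurable integrable `g` as soon as
  `∫_s f ≤ ∫_s g` on every `m`-measurable `s` (uniqueness argument on the trimmed measure);
* `integral_mul_sub_condExp` — orthogonality `∫ U · (Y - P[Y | m]) = 0` for bounded `m`-measurable `U`
  (pull-out property);
* `integral_sq_sum_le_of_orthogonal` — `∫ (Σ_{n∈I} D n)² ≤ #I · c` for pairwise orthogonal terms with
  `∫ (D n)² ≤ c`;
* `meas_sum_increments_le` — Chebyshev for the martingale part: for `0 ≤ Y n ≤ M` adapted,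
  `P{K < Σ_{n∈I} (Y n - P[Y n | G n])} ≤ #I · M² / K²`;
* small measure-theoretic bookkeeping used with them: `setIntegral_le_of_lintegral_indicator_le` (set integrals
  from indicator-tested lower integrals), `meas_lt_le_lintegral_div` (Markov in the form
  `P{K < f} ≤ (∫⁻ ofReal f)/ofReal K`), `lintegral_indicator_le_of_meas_le` (an `L¹` tail from a probability
  bound), `integrable_of_sum_lintegral_sub_le` (integrability from a budget on positive parts).

Deliberately NOT here: anything about a specific model; the continuous-time theory; Azuma–Hoeffding (see
`Literature/Probability/Moments/AzumaHoeffdingMartingalePart.lean`).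
-/

noncomputable section

open MeasureTheory Set Filter
open scoped ENNReal BigOperators

namespace Literature.Probability.Process

/-- From an inequality of lower integrals of two nonnegative integrable functions tested against the
indicator of a measurable set to the inequality of their set integrals. [folklore] -/
theorem setIntegral_le_of_lintegral_indicator_le {Ω : Type*} [MeasurableSpace Ω] {P : Measure Ω}
    {f g : Ω → ℝ} {s : Set Ω} (hs : MeasurableSet s) (hf : ∀ ω, 0 ≤ f ω) (hg : ∀ ω, 0 ≤ g ω)
    (hfi : Integrable f P) (hgi : Integrable g P)
    (h : ∫⁻ ω, ENNReal.ofReal (f ω * s.indicator (fun _ => (1 : ℝ)) ω) ∂P ≤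
      ∫⁻ ω, ENNReal.ofReal (g ω * s.indicator (fun _ => (1 : ℝ)) ω) ∂P) :
    ∫ ω in s, f ω ∂P ≤ ∫ ω in s, g ω ∂P := by
  have e : ∀ φ : Ω → ℝ, (fun ω => ENNReal.ofReal (φ ω * s.indicator (fun _ => (1 : ℝ)) ω)) =
      s.indicator (fun ω => ENNReal.ofReal (φ ω)) := by
    intro φ
    funext ω
    by_cases hω : ω ∈ s <;> simp [hω]
  rw [e f, e g, lintegral_indicator hs, lintegral_indicator hs,
    ← ofReal_integral_eq_lintegral_ofReal hfi.integrableOn (Eventually.of_forall fun ω => hf ω),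
    ← ofReal_integral_eq_lintegral_ofReal hgi.integrableOn (Eventually.of_forall fun ω => hg ω)] at h
  exact (ENNReal.ofReal_le_ofReal_iff (setIntegral_nonneg hs fun ω _ => hg ω)).1 h

/-- A conditional expectation `P[f | m]` is a.e. bounded above by an `m`-measurable integrable `g` as soon as
`∫_s f ≤ ∫_s g` for every `m`-measurable set `s` (uniqueness argument on the trimmed measure). [folklore] -/
theorem condExp_ae_le_of_setIntegral_le {Ω : Type*} {m mΩ : MeasurableSpace Ω} {P : Measure Ω}
    [IsFiniteMeasure P] (hm : m ≤ mΩ) {f g : Ω → ℝ} (hf : Integrable f P) (hg : Integrable g P)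
    (hgm : StronglyMeasurable[m] g)
    (H : ∀ s, MeasurableSet[m] s → ∫ ω in s, f ω ∂P ≤ ∫ ω in s, g ω ∂P) : P[f|m] ≤ᵐ[P] g := by
  have key : P[f|m] ≤ᵐ[P.trim hm] g := by
    refine ae_le_of_forall_setIntegral_le (integrable_condExp.trim hm stronglyMeasurable_condExp)
      (hg.trim hm hgm) fun s hs _ => ?_
    rw [← setIntegral_trim hm stronglyMeasurable_condExp hs, ← setIntegral_trim hm hgm hs,
      setIntegral_condExp hm hf hs]
    exact H s hs
  exact ae_le_of_ae_le_trim key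

/-- Orthogonality of a bounded `m`-measurable factor `U` to a centred increment `Y - P[Y | m]`:
`∫ U · (Y - P[Y | m]) dP = 0` (pull-out property and `P[Y - P[Y|m] | m] = 0`). [folklore] -/
theorem integral_mul_sub_condExp {Ω : Type*} {m mΩ : MeasurableSpace Ω} {P : Measure Ω}
    [IsFiniteMeasure P] (hm : m ≤ mΩ) {U Y : Ω → ℝ} (hU : StronglyMeasurable[m] U) {c : ℝ}
    (hUc : ∀ᵐ ω ∂P, ‖U ω‖ ≤ c) (hY : Integrable Y P) :
    ∫ ω, U ω * (Y ω - P[Y|m] ω) ∂P = 0 := by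
  have hD : Integrable (Y - P[Y|m]) P := hY.sub integrable_condExp
  have hUD : Integrable (U * (Y - P[Y|m])) P :=
    hD.bdd_mul (hU.mono hm).aestronglyMeasurable hUc
  have h1 : P[U * (Y - P[Y|m])|m] =ᵐ[P] U * P[Y - P[Y|m]|m] :=
    condExp_mul_of_stronglyMeasurable_left hU hUD hD
  have h4 : P[P[Y|m]|m] = P[Y|m] :=
    condExp_of_stronglyMeasurable hm stronglyMeasurable_condExp integrable_condExp
  have h2 : P[Y - P[Y|m]|m] =ᵐ[P] 0 := by
    have h3 : P[Y - P[Y|m]|m] =ᵐ[P] P[Y|m] - P[P[Y|m]|m] := condExp_sub hY integrable_condExp m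
    rw [h4] at h3
    refine h3.trans (Eventually.of_forall fun ω => ?_)
    simp
  calc ∫ ω, U ω * (Y ω - P[Y|m] ω) ∂P = ∫ ω, (U * (Y - P[Y|m])) ω ∂P := rfl
    _ = ∫ ω, P[U * (Y - P[Y|m])|m] ω ∂P := (integral_condExp hm).symm
    _ = ∫ _ω, (0 : ℝ) ∂P := by
        refine integral_congr_ae (h1.trans ?_)
        filter_upwards [h2] with ω hω
        simp [hω]
    _ = 0 := by simp

/-- Second moment of a finite sum of pairwise orthogonal terms: `∫ (Σ_{n∈I} D n)² ≤ #I · c` when the mixed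
moments vanish and each `∫ (D n)² ≤ c`. [folklore] -/
theorem integral_sq_sum_le_of_orthogonal {Ω : Type*} [MeasurableSpace Ω] {P : Measure Ω} (I : Finset ℕ)
    (D : ℕ → Ω → ℝ) (c : ℝ) (hint : ∀ n ∈ I, ∀ n' ∈ I, Integrable (fun ω => D n ω * D n' ω) P)
    (horth : ∀ n ∈ I, ∀ n' ∈ I, n < n' → ∫ ω, D n ω * D n' ω ∂P = 0)
    (hsq : ∀ n ∈ I, ∫ ω, D n ω * D n ω ∂P ≤ c) :
    ∫ ω, (∑ n ∈ I, D n ω) ^ 2 ∂P ≤ I.card * c := by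
  have e : ∀ ω, (∑ n ∈ I, D n ω) ^ 2 = ∑ n ∈ I, ∑ n' ∈ I, D n ω * D n' ω := fun ω => by
    rw [sq, Finset.sum_mul_sum]
  simp_rw [e]
  rw [integral_finsetSum _ fun n hn => integrable_finsetSum _ fun n' hn' => hint n hn n' hn']
  calc ∑ n ∈ I, ∫ ω, ∑ n' ∈ I, D n ω * D n' ω ∂P = ∑ n ∈ I, ∫ ω, D n ω * D n ω ∂P := by
        refine Finset.sum_congr rfl fun n hn => ?_
        rw [integral_finsetSum _ fun n' hn' => hint n hn n' hn']
        refine Finset.sum_eq_single_of_mem n hn fun n' hn' hne => ?_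
        rcases lt_or_gt_of_ne hne with h | h
        · simp_rw [mul_comm (D n _) (D n' _)]
          exact horth n' hn' n hn h
        · exact horth n hn n' hn' h
    _ ≤ ∑ _n ∈ I, c := Finset.sum_le_sum hsq
    _ = I.card * c := by rw [Finset.sum_const, nsmul_eq_mul]

/-- Markov's inequality in the form `P{K < f} ≤ (∫⁻ ofReal f) / ofReal K` for `0 < K`. [folklore] -/
theorem meas_lt_le_lintegral_div {Ω : Type*} [MeasurableSpace Ω] (P : Measure Ω) {f : Ω → ℝ}
    (hf : AEMeasurable f P) {K : ℝ} (hK : 0 < K) :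
    P {ω | K < f ω} ≤ (∫⁻ ω, ENNReal.ofReal (f ω) ∂P) / ENNReal.ofReal K := by
  calc P {ω | K < f ω} ≤ P {ω | ENNReal.ofReal K ≤ ENNReal.ofReal (f ω)} :=
        measure_mono fun ω (hω : K < f ω) => ENNReal.ofReal_le_ofReal hω.le
    _ ≤ (∫⁻ ω, ENNReal.ofReal (f ω) ∂P) / ENNReal.ofReal K :=
        meas_ge_le_lintegral_div hf.ennreal_ofReal (ENNReal.ofReal_pos.2 hK).ne' ENNReal.ofReal_ne_top

/-- Bookkeeping of the last step: if `A ≤ B + M'` pointwise with `B ≥ 0`, `∫⁻ ofReal B ≤ b` and `P{V < A} ≤ p`,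
then `∫⁻ ofReal (A · 𝟙{V < A}) ≤ b + ofReal M' · p`. [folklore] -/
theorem lintegral_indicator_le_of_meas_le {Ω : Type*} [MeasurableSpace Ω] (P : Measure Ω)
    {A B : Ω → ℝ} (hA : Measurable A) (hB0 : ∀ ω, 0 ≤ B ω) {V M' : ℝ} (hM'0 : 0 ≤ M')
    (hAB : ∀ ω, A ω ≤ B ω + M') {b p : ℝ≥0∞} (hb : ∫⁻ ω, ENNReal.ofReal (B ω) ∂P ≤ b)
    (hp : P {ω | V < A ω} ≤ p) :
    ∫⁻ ω, ENNReal.ofReal (Set.indicator {y : ℝ | V < y} (fun y => y) (A ω)) ∂P ≤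
      b + ENNReal.ofReal M' * p := by
  have hEm : MeasurableSet {ω | V < A ω} := measurableSet_lt measurable_const hA
  have hpt : ∀ ω, ENNReal.ofReal (Set.indicator {y : ℝ | V < y} (fun y => y) (A ω)) ≤
      ENNReal.ofReal (B ω) + Set.indicator {ω | V < A ω} (fun _ => ENNReal.ofReal M') ω := by
    intro ω
    by_cases hω : V < A ω
    · rw [Set.indicator_of_mem (show A ω ∈ {y : ℝ | V < y} from hω),
        Set.indicator_of_mem (show ω ∈ {ω | V < A ω} from hω), ← ENNReal.ofReal_add (hB0 ω) hM'0]
      exact ENNReal.ofReal_le_ofReal (hAB ω)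
    · rw [Set.indicator_of_notMem (show A ω ∉ {y : ℝ | V < y} from hω)]
      simp
  calc ∫⁻ ω, ENNReal.ofReal (Set.indicator {y : ℝ | V < y} (fun y => y) (A ω)) ∂P
      ≤ ∫⁻ ω, (ENNReal.ofReal (B ω) +
          Set.indicator {ω | V < A ω} (fun _ => ENNReal.ofReal M') ω) ∂P := lintegral_mono hpt
    _ = ∫⁻ ω, ENNReal.ofReal (B ω) ∂P + ENNReal.ofReal M' * P {ω | V < A ω} := by
        rw [lintegral_add_right _ (measurable_const.indicator hEm), lintegral_indicator_const hEm]
    _ ≤ b + ENNReal.ofReal M' * p := by gcongr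

/-- Integrability of the blocks from the overshoot hypothesis: a finite sum of lower integrals
`Σ_{j<K} ∫⁻ ofReal (X j - M)` bounded by a real forces each `X j`, `j < K`, nonnegative and measurable, to be
integrable (`X j ≤ |M| + (X j - M)₊`). [folklore] -/
theorem integrable_of_sum_lintegral_sub_le {Ω : Type*} [MeasurableSpace Ω] {P : Measure Ω}
    [IsFiniteMeasure P] {X : ℕ → Ω → ℝ} (hXm : ∀ j, Measurable (X j)) (hX0 : ∀ j ω, 0 ≤ X j ω)
    {K : ℕ} {M : ℝ} {b : ℝ}
    (hM : ∑ j ∈ Finset.range K, ∫⁻ ω, ENNReal.ofReal (X j ω - M) ∂P ≤ ENNReal.ofReal b) :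
    ∀ j < K, Integrable (X j) P := by
  intro j hj
  have hfin : ∫⁻ ω, ENNReal.ofReal (X j ω - M) ∂P < ∞ :=
    lt_of_le_of_lt ((Finset.single_le_sum (f := fun j => ∫⁻ ω, ENNReal.ofReal (X j ω - M) ∂P)
      (fun _ _ => zero_le) (Finset.mem_range.2 hj)).trans hM) ENNReal.ofReal_lt_top
  have hpos : Integrable (fun ω => max (X j ω - M) 0) P := by
    refine ⟨(((hXm j).sub_const M).max measurable_const).aestronglyMeasurable, ?_⟩
    rw [hasFiniteIntegral_iff_ofReal (f := fun ω => max (X j ω - M) 0)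
      (Eventually.of_forall fun ω => le_max_right _ _)]
    simpa only [ENNReal.ofReal_max, ENNReal.ofReal_zero, max_zero] using hfin
  refine (hpos.add (integrable_const |M|)).mono' (hXm j).aestronglyMeasurable
    (Eventually.of_forall fun ω => ?_)
  rw [Real.norm_eq_abs, abs_of_nonneg (hX0 j ω), Pi.add_apply]
  have h1 := le_max_left (X j ω - M) 0
  have h2 := le_abs_self M
  linarith

/-- Chebyshev bound for the martingale part `S = Σ_{n∈I} (Y n - P[Y n | G n])` of a bounded adapted sequence
`0 ≤ Y n ≤ M` along a monotone family of sub-σ-algebras `G` (`Y n` is `G n'`-measurable for `n < n'`): the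
increments are bounded by `M` and pairwise orthogonal in `L²(P)`, so `P{K < S} ≤ E[S²]/K² ≤ #I · M² / K²`. [folklore] -/
theorem meas_sum_increments_le {Ω : Type*} {mΩ : MeasurableSpace Ω} (P : Measure Ω)
    [IsProbabilityMeasure P] (G : ℕ → MeasurableSpace Ω) (hGle : ∀ n, G n ≤ mΩ) (hGmono : Monotone G)
    (Y : ℕ → Ω → ℝ) {M : ℝ} (hM0 : 0 ≤ M) (hYm : ∀ n, Measurable (Y n))
    (hYG : ∀ n n', n < n' → Measurable[G n'] (Y n)) (hY0 : ∀ n ω, 0 ≤ Y n ω)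
    (hYM : ∀ n ω, Y n ω ≤ M) (I : Finset ℕ) {K : ℝ} (hK : 0 < K) :
    P {ω | K < ∑ n ∈ I, (Y n ω - P[Y n|G n] ω)} ≤ ENNReal.ofReal (I.card * M ^ 2 / K ^ 2) := by
  obtain ⟨D, hD⟩ : ∃ D : ℕ → Ω → ℝ, ∀ n, D n = fun ω => Y n ω - P[Y n|G n] ω := ⟨_, fun _ => rfl⟩
  have hD' : ∀ n ω, Y n ω - P[Y n|G n] ω = D n ω := fun n ω => by rw [hD n]
  simp_rw [hD']
  have hYi : ∀ n, Integrable (Y n) P := fun n =>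
    Integrable.of_bound (hYm n).aestronglyMeasurable M (Eventually.of_forall fun ω => by
      rw [Real.norm_eq_abs, abs_le]
      exact ⟨by linarith [hY0 n ω], hYM n ω⟩)
  have hπM : ∀ n, P[Y n|G n] ≤ᵐ[P] fun _ => M := fun n => by
    have h := condExp_mono (m := G n) (hYi n) (integrable_const M)
      (Eventually.of_forall fun ω => hYM n ω)
    rwa [condExp_const (hGle n) M] at h
  have hπ0 : ∀ n, 0 ≤ᵐ[P] P[Y n|G n] := fun n =>
    condExp_nonneg (Eventually.of_forall fun ω => hY0 n ω)
  have hDbd : ∀ n, ∀ᵐ ω ∂P, ‖D n ω‖ ≤ M := fun n => by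
    filter_upwards [hπM n, hπ0 n] with ω h1 h2
    rw [hD n, Real.norm_eq_abs, abs_le]
    simp only [Pi.zero_apply] at h2
    constructor <;> linarith [hY0 n ω, hYM n ω]
  have hDm : ∀ n, Measurable (D n) := fun n => by
    rw [hD n]
    exact (hYm n).sub (stronglyMeasurable_condExp.mono (hGle n)).measurable
  have hDsm : ∀ n n', n < n' → StronglyMeasurable[G n'] (D n) := fun n n' h => by
    rw [hD n]
    exact (hYG n n' h).stronglyMeasurable.sub (stronglyMeasurable_condExp.mono (hGmono h.le))
  have hDi : ∀ n, Integrable (D n) P := fun n => by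
    rw [hD n]
    exact (hYi n).sub integrable_condExp
  have hDDi : ∀ n n', Integrable (fun ω => D n ω * D n' ω) P := fun n n' =>
    (hDi n').bdd_mul (hDm n).aestronglyMeasurable (hDbd n)
  have horth : ∀ n ∈ I, ∀ n' ∈ I, n < n' → ∫ ω, D n ω * D n' ω ∂P = 0 := by
    intro n _ n' _ h
    have := integral_mul_sub_condExp (hGle n') (hDsm n n' h) (hDbd n) (hYi n')
    simpa only [hD'] using this
  have hsq : ∀ n ∈ I, ∫ ω, D n ω * D n ω ∂P ≤ M ^ 2 := by
    intro n _
    calc ∫ ω, D n ω * D n ω ∂P ≤ ∫ _ω, M ^ 2 ∂P := by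
          refine integral_mono_ae (hDDi n n) (integrable_const _) ?_
          filter_upwards [hDbd n] with ω hω
          rw [Real.norm_eq_abs] at hω
          have habs : D n ω * D n ω = |D n ω| ^ 2 := by rw [sq_abs, sq]
          rw [habs]
          exact pow_le_pow_left₀ (abs_nonneg _) hω 2
      _ = M ^ 2 := by simp
  have hvar : ∫ ω, (∑ n ∈ I, D n ω) ^ 2 ∂P ≤ I.card * M ^ 2 :=
    integral_sq_sum_le_of_orthogonal I D (M ^ 2) (fun n _ n' _ => hDDi n n') horth hsq
  have hSm : Measurable fun ω => ∑ n ∈ I, D n ω := Finset.measurable_sum _ fun n _ => hDm n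
  have e : (fun ω => (∑ n ∈ I, D n ω) ^ 2) = fun ω => ∑ n ∈ I, ∑ n' ∈ I, D n ω * D n' ω := by
    funext ω
    rw [sq, Finset.sum_mul_sum]
  have hS2i : Integrable (fun ω => (∑ n ∈ I, D n ω) ^ 2) P := by
    rw [e]
    exact integrable_finsetSum _ fun n _ => integrable_finsetSum _ fun n' _ => hDDi n n'
  have hK2 : (0 : ℝ) < K ^ 2 := by positivity
  calc P {ω | K < ∑ n ∈ I, D n ω} ≤ P {ω | K ^ 2 < (∑ n ∈ I, D n ω) ^ 2} := by
        refine measure_mono fun ω hω => ?_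
        simp only [Set.mem_setOf_eq] at hω ⊢
        exact pow_lt_pow_left₀ hω hK.le two_ne_zero
    _ ≤ (∫⁻ ω, ENNReal.ofReal ((∑ n ∈ I, D n ω) ^ 2) ∂P) / ENNReal.ofReal (K ^ 2) :=
        meas_lt_le_lintegral_div P (hSm.pow_const 2).aemeasurable hK2
    _ = ENNReal.ofReal (∫ ω, (∑ n ∈ I, D n ω) ^ 2 ∂P) / ENNReal.ofReal (K ^ 2) := by
        rw [ofReal_integral_eq_lintegral_ofReal hS2i (Eventually.of_forall fun ω => sq_nonneg _)]
    _ ≤ ENNReal.ofReal (I.card * M ^ 2) / ENNReal.ofReal (K ^ 2) := by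
        gcongr
    _ = ENNReal.ofReal (I.card * M ^ 2 / K ^ 2) := (ENNReal.ofReal_div_of_pos hK2).symm

end Literature.Probability.Process

end
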